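import Summits.HodgeConjecture.CorCM.HypDel.ExtAmbientReceptacleHDel
import Summits.HodgeConjecture.CorCM.HypDel.ExtAmbientReceptacleQArchC
import Summits.HodgeConjecture.HodgeConjecture.Theorems.F1ExtHodgeTypeStubFrame
import Summits.HodgeConjecture.HodgeConjecture.Theorems.F1ExtHodgeTypeStubS2inj
import Summits.HodgeConjecture.HodgeConjecture.Theorems.F1ExtHodgeTypeStubS2Pair
import Summits.HodgeConjecture.HodgeConjecture.Theorems.F1ExtHodgeTypeStubS2Imm
import Summits.HodgeConjecture.HodgeConjecture.Theorems.F1ExtHodgeTypeStubS4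
import Summits.HodgeConjecture.HodgeConjecture.Theorems.F1ExtHodgeTypeStubSQuot
import Summits.HodgeConjecture.HodgeConjecture.Theorems.F1ExtHodgeTypeStubS2ImmHolds
import Literature.AlgebraicGeometry.ShimuraVarieties.SiegelBorelExtensionHolds
import HarnessLib

/-!
# `HDel` ([Deligne 1979] 2.2.5 / Cor. 2.7.21 for the compact unitary datum, binder `hDel` = I-1′ `canonicalModel_exists_ext_printed`)
# from TWO GENERIC NAMED FACTS: (σ4)-D `SiegelS1` ([Deligne 1971] Thm 4.21 for `GSp`, row #60) and (σ5) `siegel_borel_extension`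
# ([Borel 1972] Thm 3.10 / [Milne ISV] Thm 3.14 + 3.12, row #61) — the T3 line `Cruxes/HDel/Lines/F1ExtHodgeType.lean` assembled BY NAME

Cell `hodgecm-mathlib`, crux `HDel` (stmt-HodgeConjecture-24835), director g6 RULING s83 (2): ONE file, ONE head
`HDel_of_two_facts (hS1 : SiegelS1) (hB : siegel_borel_extension) : …Theses.HCCMUnconditional.HDel`, composed of ★ F4 `HDel_of_receptacle`
(B-p19; image stability, closure descent, canonicity — [Del71] §5, [Del79] 2.3.10) ∘ ★ QArchC `QArch.ambientReceptacle_of'` (the Q-architecture head: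
Siegel receptacle = finite Hecke quotient of a principal-level Siegel modular variety reached through the symplectic embedding of the auxiliary
datum) over the five PROVED T3 closers: ★ `stub_frame` (B-p03 g7, p649453: auxiliary scalars, symplectic frame, product levels) ·
★ `stub_S2inj` (A-p05 g6, p649252: point-injectivity at product level) · ★ `stub_S2pair_holds hB stub_periodChart_holds` (A-p08 g6, p647285:
the morphism `ι′` with its point formula — α B-p09 p645594 + β p646597 + Borel) · ★ `S2Imm_of_periodChart stub_periodChart_holds` (B-p05 g6,
p645479 + p650963: closed immersion; the PERIOD CHART of `J_{β,Φ}` = TARGET 1 `UnitaryAuxiliaryPeriodMap`, left-eigenrow route) ·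
★ `QArch.stub_Squot` (B-p01 g6, p650383: the finite-quotient `E`-receptacle with Galois-intertwining points map) · ★ `stub_S4` (A-p04 g7, p650008:
Siegel reciprocity pushed down).  THEOREMS ONLY; `--supports stmt-HodgeConjecture-24835 --as helper`.

BOOKS (director s83 (2)/(3), ERRATUM 16:09Z): this does NOT close item 24835 — `HDel` is proved here from TWO FACT binders (fan-B rows #60, #61,
both GENERIC: a theorem about the Siegel modular variety and Borel's extension theorem, neither specific to Liu's datum), so fan A is unchanged;
it is the head the GENERIC FLOOR edition `HCCMUnconditionalOfGenericFloor.lean :: hc_cm_of_generic_floor_v1 (hS1) (hBorel) …` (B-plan1) consumes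
in place of `HypDel.HDel_of_ext' hF1e`.  HC_CM is proved only modulo the 7 printed citations until rung 0 closes.

## References
* [Deligne1971TravauxShimura] P. Deligne, *Travaux de Shimura*, Sém. Bourbaki 389 (1971), §5 (5.11), Thm 4.21, Prop 1.15, 5.4.
* [Deligne1979ShimuraVarieties] P. Deligne, *Variétés de Shimura* (1979), 2.2.5, Prop. 2.3.10, Cor. 2.7.21.
* [Milne2005ShimuraVarieties] J. S. Milne, *Introduction to Shimura varieties* (2005), Thm 3.12, Thm 3.14, §12 (62), §14 Prop 14.12.
* [Borel1972ExtensionTheorem] A. Borel, J. Differential Geom. 6 (1972) 543–560, Thm. 3.10.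
-/

set_option autoImplicit false

-- mandated namespace `Summit.HodgeConjecture.HodgeConjecture.Theorems` trips `linter.dupNamespace` (single-problem summit; the lakefile turns
-- the linter off tree-wide as a weak option), restated here so stand-alone elaboration is warning-free.
set_option linter.dupNamespace false

noncomputable section

open Literature.AlgebraicGeometry.ModuliOfAbelianVarieties (SiegelS1)
open Summit.HodgeConjecture.CorCM.HypDel.ExtReceptacle (AmbientReceptacleExists HDel_of_receptacle)
open Summit.HodgeConjecture.CorCM.HypDel.ExtReceptacle (QArch.FrameExists' QArch.S2Inj QArch.S2Pair QArch.S2Imm QArch.SQuot QArch.S4Push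
  QArch.ambientReceptacle_of')
open Summit.HodgeConjecture.CorCM.HypDel.ExtReceptacle.QArch (IsAuxScalars)
open Literature.AlgebraicGeometry.ShimuraVarieties (siegel_borel_extension)
open Function NumberField Matrix
open scoped Matrix ComplexOrder
open Literature.AlgebraicGeometry Literature.AlgebraicGeometry.Motives
open Literature.NumberTheory.Automorphic Literature.NumberTheory.Automorphic.UnitaryGroup
open Literature.Geometry.ComplexHyperbolic Literature.Geometry.ComplexHyperbolic.BallModel
open Literature.AlgebraicGeometry.ShimuraVarieties Literature.AlgebraicGeometry.ShimuraVarieties.UnitaryCanonicalModel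
open Literature.AlgebraicGeometry.ShimuraVarieties.UnitaryCanonicalModel.Aux
open Literature.AlgebraicGeometry.ModuliOfAbelianVarieties
open Literature.AlgebraicGeometry.ModuliOfAbelianVarieties.SiegelModuli (C0 jOfSiegel)
open Literature.NumberTheory.ModularForms.SiegelUpperHalfSpace (siegelUpperHalfSpaceCoord coordCLE)
open Literature.LinearAlgebra.Matrix (symmetricSubmodule)

namespace Summit.HodgeConjecture.HodgeConjecture.Theorems

/-- **`HDel` from the two GENERIC named facts (σ4)-D `SiegelS1` and (σ5) `siegel_borel_extension`** (director g6 RULING s83 (2)): the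
canonical model of the E-extended auxiliary Hodge-type datum (I-1′ `canonicalModel_exists_ext_printed`, hence `HDel`) exists, by ★ `HDel_of_receptacle`
∘ ★ `QArch.ambientReceptacle_of'` over the five proved T3 closers ★ `stub_frame` · ★ `stub_S2inj` · ★ `stub_S2pair_holds` · ★ `S2Imm_of_periodChart`
(both fed the ★ period chart `stub_periodChart_holds`) · ★ `QArch.stub_Squot` · ★ `stub_S4`.  Two FACT binders remain; nothing else.
[cite: Deligne1971TravauxShimura, §5 (5.11), Thm 4.21, Prop 1.15, 5.4] [cite: Deligne1979ShimuraVarieties, 2.2.5, Prop. 2.3.10, Cor. 2.7.21]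
[cite: Milne2005ShimuraVarieties, Thm 3.14, §14 Prop 14.12, §12 (62)] [cite: Borel1972ExtensionTheorem, Thm. 3.10 p. 559] -/
theorem HDel_of_two_facts (hS1 : SiegelS1) (hB : siegel_borel_extension) :
    Summit.HodgeConjecture.HodgeConjecture.Theses.HCCMUnconditional.HDel :=
  HDel_of_receptacle
    (QArch.ambientReceptacle_of' hS1 stub_frame stub_S2inj (stub_S2pair_holds hB stub_periodChart_holds)
      (S2Imm_of_periodChart stub_periodChart_holds) Summit.HodgeConjecture.CorCM.HypDel.ExtReceptacle.QArch.stub_Squot stub_S4)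

/-- **`HDel` from the ONE generic named fact (σ4)-D `SiegelS1`** (APPEND 2026-08-28: row #61 `siegel_borel_extension` became the
THEOREM ★ `siegel_borel_extension_holds`, A-p14 g6 p653988 over B-p20/B-p03/B-p13's #61 chain — Chow + ZMT per piece): the canonical
model of the compact unitary datum (I-1′, hence `HDel`) from [Deligne 1971] Thm 4.21 for `GSp` alone.
[cite: Deligne1971TravauxShimura, §5 (5.11), Thm 4.21] [cite: Deligne1979ShimuraVarieties, 2.2.5, Prop. 2.3.10, Cor. 2.7.21]
[cite: Borel1972ExtensionTheorem, Thm. 3.10 p. 559] -/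
theorem HDel_of_S1 (hS1 : SiegelS1) : Summit.HodgeConjecture.HodgeConjecture.Theses.HCCMUnconditional.HDel :=
  HDel_of_two_facts hS1 Literature.AlgebraicGeometry.ShimuraVarieties.siegel_borel_extension_holds

end Summit.HodgeConjecture.HodgeConjecture.Theorems

end
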